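import Literature.Topology.FourManifolds.GompfProductTwist
import Literature.Topology.FourManifolds.OpenEmbeddingExtend
import HarnessLib

/-!
# Locality of Gompf's twisting criterion: twisting data only depend on the monodromy near the cylinder of `α`

Infrastructure for the framed form of R. Gompf, *More Cappell–Shaneson spheres are standard*,
Algebr. Geom. Topol. 10 (2010), Theorem 2.1 (the named fact
`Literature.Topology.FourManifolds.gompf2010_framedTwist`). The twist criterion
`nonempty_diffeomorph_prodSurgered_of_twistingDiffeo` (`GompfProductTwist.lean`) asks, for a
monodromy `ψ` of `T³` which is the identity near the base point, for a diffeomorphism `G` of the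
product-framed surgery `X = prodSurgered ψ ε` minus the fibre sliver `Σ` which twists across the
sliver by the Dehn twist on a neighbourhood `V_δ` — *twisting data* for `ψ`. Gompf's proof of
Theorem 2.1 produces `G` inside a fishtail neighbourhood built from the box `N` (near one fibre)
and the punctured torus swept by the cylinder over the circle `α` (loc. cit., proof of Thm 2.1);
so `G` is the identity off a neighbourhood of *one fibre and of the cylinder over a tube `V`
around `α`*, and the construction only sees the monodromy on that tube. This file proves the
corresponding transfer principle in the tree's language:

* `Literature.Topology.FourManifolds.cylSlide K φ₀` — the level-preserving diffeomorphism
  `(x, s) ↦ (φ₀ (K_s x), s)` of the first cylinder `T³ × (0, 1)` given by a diffeotopy `K` of `T³`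
  and a diffeomorphism `φ₀` (the *sliding family* `e_s = φ₀ ∘ K_s`);
* `Literature.Topology.FourManifolds.twistNbhd ψ η V K φ₀ ⊆ X_ψ` — **the twisted cylinder
  neighbourhood**: the bicollar `T³ × (1 - η, 1 + η)` of the fibre through the sliver together with
  the twisted cylinder `{[e_s x, s] | x ∈ V, s ∈ (0, 1)}`; it is an open gluing of the pieces
  `V × (0, 1)` and `T³ × (1 - η, 1 + η)` along a relation which only involves `e_s|_V` for
  `s > 1 - η` and `ψ ∘ e_s|_V` for `s < η` (`isOpenGluingWith_twistNbhd`,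
  `Literature.Topology.FourManifolds.twistNbhdRel`);
* `Literature.Topology.FourManifolds.exists_twistingDiffeo_transfer` — **the transfer theorem**:
  if `ψ, ψ'` (both the identity on `expT (B(0, ε))`) and sliding families `e, e'` (both the identity
  on `expT (B(0, ε)) ⊆ V`) satisfy `e_s = e'_s` on `V` for `s ∈ (1 - η, 1)` and
  `ψ ∘ e_s = ψ' ∘ e'_s` on `V` for `s ∈ (0, η)`, then twisting data `G` for `ψ` (w.r.t. a twist
  `g`, a closed `S ⊆ T³`, a neighbourhood `V_δ` of the sliver inside the bicollar) which is the
  identity off a closed set contained in `twistNbhd ψ η V K φ₀` surgered yields twisting data for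
  `ψ'` w.r.t. the same `g, S, V_δ`, again supported in the twisted cylinder neighbourhood. Proof:
  the two neighbourhoods are open gluings of the same pieces along the same relation, hence
  diffeomorphic with witnesses (`IsOpenGluingWith.exists_diffeomorph_apply_eq`); the
  diffeomorphism carries product tube to product tube, so it passes to the surgered neighbourhoods
  (`CircleNbhd.exists_diffeomorph_localOpens`); conjugate `G` and extend by the identity
  (`exists_diffeomorph_extend`).

With the identity family on the model side and `e'_s = (ψ'⁻¹ ∘ ψ₀) ∘ k_s` on the other side this
transfers Gompf's fishtail diffeomorphism from one straightened model to every straightened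
monodromy agreeing with it, up to a based isotopy `k`, on a tube around `α`.

Everything here is proved; no named facts are introduced.

## References

* R. E. Gompf, *More Cappell–Shaneson spheres are standard*, Algebr. Geom. Topol. 10 (2010)
  1665–1681: proof of Thm 2.1 (the construction lives in a neighbourhood of `N ∪ F′`) and its last
  paragraph. [GompfAGT2010]
* A. Kosinski, *Differential Manifolds* (1993), Ch. VI §1 (uniqueness of gluing). [Kosinski1993]
* M. W. Hirsch, *Differential Topology*, GTM 33 (1976), Ch. 8 §1, Thm. 1.3. [Hirsch1976]
-/

open scoped Manifold ContDiff Topology Real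
open Set Function Metric

noncomputable section

namespace Literature.Topology.FourManifolds

/-- Local notation: `𝔼 n` is the model Euclidean space `EuclideanSpace ℝ (Fin n)`. -/
local notation "𝔼 " n:arg => EuclideanSpace ℝ (Fin n)

/-- Local notation: `𝕊 n` is the unit sphere in `EuclideanSpace ℝ (Fin (n + 1))`. -/
local notation "𝕊 " n:arg => (Metric.sphere (0 : EuclideanSpace ℝ (Fin (n + 1))) 1)

/-- Local notation: the model with corners `𝓣 = (𝓡 1).prod ((𝓡 1).prod (𝓡 1))` of `ThreeTorus`. -/
local notation "𝓣" =>
  (ModelWithCorners.prod (𝓡 1) (ModelWithCorners.prod (𝓡 1) (𝓡 1)))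

attribute [local instance] fact_finrank_euclideanSpace_succ

/-! ### The sliding family and the level-preserving slide of the first cylinder -/

section Slide

variable (K : Diffeotopy 𝓣 ThreeTorus) (φ₀ : ThreeTorus ≃ₘ⟮𝓣, 𝓣⟯ ThreeTorus)

/-- **The sliding family** `e_s = φ₀ ∘ K_s` of a diffeotopy `K` and a diffeomorphism `φ₀`. [folklore] -/
def slideFun (s : ℝ) (x : ThreeTorus) : ThreeTorus := φ₀ (K.toFun s x)

/-- The inverse sliding family `e_s⁻¹ = K_s⁻¹ ∘ φ₀⁻¹`. [folklore] -/
def slideInv (s : ℝ) (y : ThreeTorus) : ThreeTorus := K.invFun s (φ₀.symm y)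

/-- `e_s⁻¹ (e_s x) = x`. [folklore] -/
@[simp] theorem slideInv_slideFun (s : ℝ) (x : ThreeTorus) : slideInv K φ₀ s (slideFun K φ₀ s x) = x := by
  simp [slideInv, slideFun]

/-- `e_s (e_s⁻¹ y) = y`. [folklore] -/
@[simp] theorem slideFun_slideInv (s : ℝ) (y : ThreeTorus) : slideFun K φ₀ s (slideInv K φ₀ s y) = y := by
  simp [slideInv, slideFun]

/-- The sliding family is jointly smooth. [folklore] -/
theorem contMDiff_slideFun_uncurry : ContMDiff (𝓘(ℝ, ℝ).prod 𝓣) 𝓣 ∞ (uncurry (slideFun K φ₀)) :=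
  φ₀.contMDiff.comp K.contMDiff_uncurry_toFun

/-- The inverse sliding family is jointly smooth. [folklore] -/
theorem contMDiff_slideInv_uncurry : ContMDiff (𝓘(ℝ, ℝ).prod 𝓣) 𝓣 ∞ (uncurry (slideInv K φ₀)) := by
  have h : ContMDiff (𝓘(ℝ, ℝ).prod 𝓣) (𝓘(ℝ, ℝ).prod 𝓣) ∞ fun p : ℝ × ThreeTorus ↦ (p.1, φ₀.symm p.2) :=
    contMDiff_fst.prodMk (φ₀.symm.contMDiff.comp contMDiff_snd)
  exact K.contMDiff_uncurry_invFun.comp h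

/-- **The level-preserving slide of the first cylinder** `(x, s) ↦ (e_s x, s)`. [folklore] -/
def cylSlide : (ThreeTorus × ↥mappingTorusPieceOne) ≃ₘ⟮(ModelWithCorners.prod 𝓣 𝓘(ℝ, ℝ)), (ModelWithCorners.prod 𝓣 𝓘(ℝ, ℝ))⟯
    (ThreeTorus × ↥mappingTorusPieceOne) where
  toFun a := (slideFun K φ₀ a.2 a.1, a.2)
  invFun a := (slideInv K φ₀ a.2 a.1, a.2)
  left_inv a := by simp
  right_inv a := by simp
  contMDiff_toFun := by
    refine ContMDiff.prodMk ?_ contMDiff_snd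
    have h : ContMDiff ((ModelWithCorners.prod 𝓣 𝓘(ℝ, ℝ))) (𝓘(ℝ, ℝ).prod 𝓣) ∞
        fun a : ThreeTorus × ↥mappingTorusPieceOne ↦ ((a.2 : ℝ), a.1) :=
      (contMDiff_subtype_val.comp contMDiff_snd).prodMk contMDiff_fst
    exact (contMDiff_slideFun_uncurry K φ₀).comp h
  contMDiff_invFun := by
    refine ContMDiff.prodMk ?_ contMDiff_snd
    have h : ContMDiff ((ModelWithCorners.prod 𝓣 𝓘(ℝ, ℝ))) (𝓘(ℝ, ℝ).prod 𝓣) ∞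
        fun a : ThreeTorus × ↥mappingTorusPieceOne ↦ ((a.2 : ℝ), a.1) :=
      (contMDiff_subtype_val.comp contMDiff_snd).prodMk contMDiff_fst
    exact (contMDiff_slideInv_uncurry K φ₀).comp h

/-- The slide, pointwise. [folklore] -/
@[simp] theorem cylSlide_apply (a : ThreeTorus × ↥mappingTorusPieceOne) :
    cylSlide K φ₀ a = (slideFun K φ₀ a.2 a.1, a.2) := rfl

/-- The inverse slide, pointwise. [folklore] -/
@[simp] theorem cylSlide_symm_apply (a : ThreeTorus × ↥mappingTorusPieceOne) :
    (cylSlide K φ₀).symm a = (slideInv K φ₀ a.2 a.1, a.2) := rfl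

end Slide

/-! ### The twisted cylinder neighbourhood and its open-gluing structure -/

section Nbhd

variable (ψ : ThreeTorus ≃ₘ⟮𝓣, 𝓣⟯ ThreeTorus) (η : ℝ) (V : TopologicalSpace.Opens ThreeTorus)
  (K : Diffeotopy 𝓣 ThreeTorus) (φ₀ : ThreeTorus ≃ₘ⟮𝓣, 𝓣⟯ ThreeTorus)

/-- **The cylinder piece** `V × (0, 1)` (an open subset of the first cylinder). [folklore] -/
def cylPiece : TopologicalSpace.Opens (ThreeTorus × ↥mappingTorusPieceOne) :=
  ⟨{a | a.1 ∈ V}, V.2.preimage continuous_fst⟩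

/-- Membership in the cylinder piece. [folklore] -/
@[simp] theorem mem_cylPiece {a : ThreeTorus × ↥mappingTorusPieceOne} : a ∈ cylPiece V ↔ a.1 ∈ V := Iff.rfl

/-- **The bicollar piece** `T³ × (1 - η, 1 + η)` of the fibre carrying the sliver (an open subset of
the second cylinder). [cite: GompfAGT2010, Thm 2.1 (proof: the bicollaring I₀ × M of M in X_φ)] -/
def bicollarPiece : TopologicalSpace.Opens (ThreeTorus × ↥mappingTorusPieceTwo) :=
  ⟨{b | 1 - η < (b.2 : ℝ) ∧ (b.2 : ℝ) < 1 + η}, by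
    have hc : Continuous fun b : ThreeTorus × ↥mappingTorusPieceTwo ↦ (b.2 : ℝ) :=
      continuous_subtype_val.comp continuous_snd
    exact (isOpen_lt continuous_const hc).inter (isOpen_lt hc continuous_const)⟩

/-- Membership in the bicollar piece. [folklore] -/
@[simp] theorem mem_bicollarPiece {b : ThreeTorus × ↥mappingTorusPieceTwo} :
    b ∈ bicollarPiece η ↔ 1 - η < (b.2 : ℝ) ∧ (b.2 : ℝ) < 1 + η := Iff.rfl

/-- The cylinder map `(x, s) ↦ [e_s x, s] ∈ X_ψ` on the cylinder piece. [folklore] -/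
def cylMap (a : ↥(cylPiece V)) : MTorus ψ := (mtGlueData ψ).inl (cylSlide K φ₀ a)

/-- The bicollar map `(y, t) ↦ [y, t] ∈ X_ψ` on the bicollar piece. [folklore] -/
def bicollarMap (b : ↥(bicollarPiece η)) : MTorus ψ := (mtGlueData ψ).inr b

/-- The range of the cylinder map is `inl (slide (V × (0, 1)))`. [folklore] -/
theorem range_cylMap :
    range (cylMap ψ V K φ₀) = (mtGlueData ψ).inl '' (cylSlide K φ₀ '' (cylPiece V : Set _)) := by
  rw [image_image, image_eq_range]
  rfl

/-- The range of the cylinder map is open. [folklore] -/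
theorem isOpen_range_cylMap : IsOpen (range (cylMap ψ V K φ₀)) := by
  rw [range_cylMap]
  exact (mtGlueData ψ).isOpenMap_inl _ ((cylSlide K φ₀).toHomeomorph.isOpenMap _ (cylPiece V).2)

/-- The range of the bicollar map is `inr (T³ × (1 - η, 1 + η))`. [folklore] -/
theorem range_bicollarMap : range (bicollarMap ψ η) = (mtGlueData ψ).inr '' (bicollarPiece η : Set _) := by
  rw [image_eq_range]
  rfl

/-- The range of the bicollar map is open. [folklore] -/
theorem isOpen_range_bicollarMap : IsOpen (range (bicollarMap ψ η)) := by
  rw [range_bicollarMap]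
  exact (mtGlueData ψ).isOpenMap_inr _ (bicollarPiece η).2

/-- **The twisted cylinder neighbourhood** `U_ψ(e) = {[e_s x, s] | x ∈ V} ∪ T³ × (1 - η, 1 + η) ⊆ X_ψ`
— a neighbourhood of the fibre through the sliver and of the (twisted) cylinder over the tube `V`
around `α`, containing Gompf's box `N` and punctured torus `F′`. [cite: GompfAGT2010, Thm 2.1 (proof: N ⊂ I₀ × M and the punctured torus F′)] -/
def twistNbhd : TopologicalSpace.Opens (MTorus ψ) :=
  ⟨range (cylMap ψ V K φ₀) ∪ range (bicollarMap ψ η),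
    (isOpen_range_cylMap ψ V K φ₀).union (isOpen_range_bicollarMap ψ η)⟩

/-- Membership in the twisted cylinder neighbourhood. [folklore] -/
theorem mem_twistNbhd_iff {p : MTorus ψ} :
    p ∈ twistNbhd ψ η V K φ₀ ↔ (∃ a, cylMap ψ V K φ₀ a = p) ∨ ∃ b, bicollarMap ψ η b = p :=
  Iff.rfl

/-- Cylinder points lie in the neighbourhood. [folklore] -/
theorem cylMap_mem (a : ↥(cylPiece V)) : cylMap ψ V K φ₀ a ∈ twistNbhd ψ η V K φ₀ := Or.inl ⟨a, rfl⟩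

/-- Bicollar points lie in the neighbourhood. [folklore] -/
theorem bicollarMap_mem (b : ↥(bicollarPiece η)) : bicollarMap ψ η b ∈ twistNbhd ψ η V K φ₀ :=
  Or.inr ⟨b, rfl⟩

/-- The cylinder map into the neighbourhood. [folklore] -/
def cylEmb (a : ↥(cylPiece V)) : ↥(twistNbhd ψ η V K φ₀) := ⟨cylMap ψ V K φ₀ a, cylMap_mem ψ η V K φ₀ a⟩

/-- The bicollar map into the neighbourhood. [folklore] -/
def bicollarEmb (b : ↥(bicollarPiece η)) : ↥(twistNbhd ψ η V K φ₀) :=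
  ⟨bicollarMap ψ η b, bicollarMap_mem ψ η V K φ₀ b⟩

/-- The value of `cylEmb`. [folklore] -/
@[simp] theorem coe_cylEmb (a : ↥(cylPiece V)) :
    (cylEmb ψ η V K φ₀ a : MTorus ψ) = (mtGlueData ψ).inl (cylSlide K φ₀ a) := rfl

/-- The value of `bicollarEmb`. [folklore] -/
@[simp] theorem coe_bicollarEmb (b : ↥(bicollarPiece η)) :
    (bicollarEmb ψ η V K φ₀ b : MTorus ψ) = (mtGlueData ψ).inr b := rfl

/-- **The gluing relation of the twisted cylinder neighbourhood**: `(x, s) ∼ (y, t)` iff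
`t = s ∧ y = e_s x` (the identically glued overlap, `s ∈ (1 - η, 1)`) or `t = s + 1 ∧ y = ψ (e_s x)`
(the monodromy overlap, `s ∈ (0, η)`) — `mappingTorusRel ψ` after the slide. It only involves
`e_s|_V` for `s > 1 - η` and `ψ ∘ e_s|_V` for `s < η`. [folklore] -/
def twistNbhdRel (a : ↥(cylPiece V)) (b : ↥(bicollarPiece η)) : Prop :=
  mappingTorusRel ψ (cylSlide K φ₀ a) b

/-- `cylEmb` is a smooth embedding. [folklore] -/
theorem isSmoothEmbedding_cylEmb :
    Manifold.IsSmoothEmbedding ((ModelWithCorners.prod 𝓣 𝓘(ℝ, ℝ))) (𝓡 4) ∞ (cylEmb ψ η V K φ₀) :=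
  (isSmoothEmbedding_comp_val_opens (cylPiece V)
    ((mtGlueData ψ).isSmoothEmbedding_inl.comp_diffeomorph (cylSlide K φ₀))).codRestrict_opens
    (twistNbhd ψ η V K φ₀) fun a ↦ cylMap_mem ψ η V K φ₀ a

/-- `bicollarEmb` is a smooth embedding. [folklore] -/
theorem isSmoothEmbedding_bicollarEmb :
    Manifold.IsSmoothEmbedding ((ModelWithCorners.prod 𝓣 𝓘(ℝ, ℝ))) (𝓡 4) ∞ (bicollarEmb ψ η V K φ₀) :=
  (isSmoothEmbedding_comp_val_opens (bicollarPiece η) (mtGlueData ψ).isSmoothEmbedding_inr).codRestrict_opens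
    (twistNbhd ψ η V K φ₀) fun b ↦ bicollarMap_mem ψ η V K φ₀ b

/-- The range of `cylEmb` is open. [folklore] -/
theorem isOpen_range_cylEmb : IsOpen (range (cylEmb ψ η V K φ₀)) := by
  have h : range (cylEmb ψ η V K φ₀) = Subtype.val ⁻¹' range (cylMap ψ V K φ₀) := by
    ext p
    constructor
    · rintro ⟨a, rfl⟩
      exact ⟨a, rfl⟩
    · rintro ⟨a, ha⟩
      exact ⟨a, Subtype.ext ha⟩
  rw [h]
  exact (isOpen_range_cylMap ψ V K φ₀).preimage continuous_subtype_val

/-- The range of `bicollarEmb` is open. [folklore] -/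
theorem isOpen_range_bicollarEmb : IsOpen (range (bicollarEmb ψ η V K φ₀)) := by
  have h : range (bicollarEmb ψ η V K φ₀) = Subtype.val ⁻¹' range (bicollarMap ψ η) := by
    ext p
    constructor
    · rintro ⟨b, rfl⟩
      exact ⟨b, rfl⟩
    · rintro ⟨b, hb⟩
      exact ⟨b, Subtype.ext hb⟩
  rw [h]
  exact (isOpen_range_bicollarMap ψ η).preimage continuous_subtype_val

/-- **The twisted cylinder neighbourhood is an open gluing of `V × (0, 1)` and `T³ × (1 - η, 1 + η)`
along `twistNbhdRel`.** [cite: Kosinski1993, Ch. VI §1] -/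
theorem isOpenGluingWith_twistNbhd :
    IsOpenGluingWith ((ModelWithCorners.prod 𝓣 𝓘(ℝ, ℝ))) ((ModelWithCorners.prod 𝓣 𝓘(ℝ, ℝ))) (𝓡 4) (twistNbhdRel ψ η V K φ₀)
      (cylEmb ψ η V K φ₀) (bicollarEmb ψ η V K φ₀) := by
  refine ⟨isSmoothEmbedding_cylEmb ψ η V K φ₀, isOpen_range_cylEmb ψ η V K φ₀,
    isSmoothEmbedding_bicollarEmb ψ η V K φ₀, isOpen_range_bicollarEmb ψ η V K φ₀, ?_, fun a b ↦ ?_⟩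
  · refine eq_univ_iff_forall.2 fun p ↦ ?_
    rcases p.2 with ⟨a, ha⟩ | ⟨b, hb⟩
    · exact Or.inl ⟨a, Subtype.ext ha⟩
    · exact Or.inr ⟨b, Subtype.ext hb⟩
  · rw [Subtype.ext_iff, coe_cylEmb, coe_bicollarEmb, mappingTorusGlued_inl_eq_inr_iff]
    rfl

variable {ψ η V K φ₀}

/-- **The relation only involves `e_s|_V` near the top and `ψ ∘ e_s|_V` near the bottom**: if two
monodromies and sliding families agree there (`0 < η`), the relations coincide. [folklore] -/
theorem twistNbhdRel_iff {ψ' : ThreeTorus ≃ₘ⟮𝓣, 𝓣⟯ ThreeTorus} {K' : Diffeotopy 𝓣 ThreeTorus}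
    {φ₀' : ThreeTorus ≃ₘ⟮𝓣, 𝓣⟯ ThreeTorus}
    (htop : ∀ s : ℝ, 1 - η < s → s < 1 → ∀ x ∈ V, slideFun K φ₀ s x = slideFun K' φ₀' s x)
    (hbot : ∀ s : ℝ, 0 < s → s < η → ∀ x ∈ V, ψ (slideFun K φ₀ s x) = ψ' (slideFun K' φ₀' s x))
    (a : ↥(cylPiece V)) (b : ↥(bicollarPiece η)) :
    twistNbhdRel ψ η V K φ₀ a b ↔ twistNbhdRel ψ' η V K' φ₀' a b := by
  obtain ⟨⟨x, s⟩, hx⟩ := a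
  obtain ⟨⟨y, t⟩, ht⟩ := b
  simp only [mem_cylPiece] at hx
  simp only [mem_bicollarPiece] at ht
  have hs := mem_mappingTorusPieceOne.1 s.2
  simp only [twistNbhdRel, mappingTorusRel, cylSlide_apply]
  constructor
  · rintro (⟨h1, h2⟩ | ⟨h1, h2⟩)
    · left
      refine ⟨h1, ?_⟩
      rw [h2]
      exact htop _ (by linarith [ht.1]) hs.2 x hx
    · right
      refine ⟨h1, ?_⟩
      rw [h2]
      exact hbot _ hs.1 (by linarith [ht.2]) x hx
  · rintro (⟨h1, h2⟩ | ⟨h1, h2⟩)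
    · left
      refine ⟨h1, ?_⟩
      rw [h2]
      exact (htop _ (by linarith [ht.1]) hs.2 x hx).symm
    · right
      refine ⟨h1, ?_⟩
      rw [h2]
      exact (hbot _ hs.1 (by linarith [ht.2]) x hx).symm

end Nbhd

/-! ### Comparing two twisted cylinder neighbourhoods -/

section Compare

variable (ψ ψ' : ThreeTorus ≃ₘ⟮𝓣, 𝓣⟯ ThreeTorus) {ε : ℝ} (hε : 0 < ε) (hεπ : ε ≤ π)
  (hψ : ∀ v : 𝔼 3, ‖v‖ < ε → ψ (expT v) = expT v)
  (hψ' : ∀ v : 𝔼 3, ‖v‖ < ε → ψ' (expT v) = expT v)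
  {η : ℝ} (hη : 0 < η) (V : TopologicalSpace.Opens ThreeTorus)
  (K K' : Diffeotopy 𝓣 ThreeTorus) (φ₀ φ₀' : ThreeTorus ≃ₘ⟮𝓣, 𝓣⟯ ThreeTorus)
  (hVε : ∀ v : 𝔼 3, ‖v‖ < ε → expT v ∈ V)
  (he : ∀ (s : ℝ) (v : 𝔼 3), ‖v‖ < ε → slideFun K φ₀ s (expT v) = expT v)
  (he' : ∀ (s : ℝ) (v : 𝔼 3), ‖v‖ < ε → slideFun K' φ₀' s (expT v) = expT v)
  (htop : ∀ s : ℝ, 1 - η < s → s < 1 → ∀ x ∈ V, slideFun K φ₀ s x = slideFun K' φ₀' s x)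
  (hbot : ∀ s : ℝ, 0 < s → s < η → ∀ x ∈ V, ψ (slideFun K φ₀ s x) = ψ' (slideFun K' φ₀' s x))

include htop hbot in
/-- **Two twisted cylinder neighbourhoods with matching data are diffeomorphic, with witnesses**
(uniqueness of open gluings along the common relation). [cite: Kosinski1993, Ch. VI §1, proof of Thm (1.1)] -/
theorem exists_slideDiffeomorph :
    ∃ Θ : ↥(twistNbhd ψ η V K φ₀) ≃ₘ⟮𝓡 4, 𝓡 4⟯ ↥(twistNbhd ψ' η V K' φ₀'),
      (∀ a, Θ (cylEmb ψ η V K φ₀ a) = cylEmb ψ' η V K' φ₀' a) ∧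
        ∀ b, Θ (bicollarEmb ψ η V K φ₀ b) = bicollarEmb ψ' η V K' φ₀' b := by
  have h := isOpenGluingWith_twistNbhd ψ η V K φ₀
  obtain ⟨h1, h2, h3, h4, h5, h6⟩ := isOpenGluingWith_twistNbhd ψ' η V K' φ₀'
  have h' : IsOpenGluingWith ((ModelWithCorners.prod 𝓣 𝓘(ℝ, ℝ))) ((ModelWithCorners.prod 𝓣 𝓘(ℝ, ℝ))) (𝓡 4)
      (twistNbhdRel ψ η V K φ₀) (cylEmb ψ' η V K' φ₀') (bicollarEmb ψ' η V K' φ₀') :=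
    ⟨h1, h2, h3, h4, h5, fun a b ↦ (h6 a b).trans (twistNbhdRel_iff htop hbot a b).symm⟩
  exact h.exists_diffeomorph_apply_eq h'

include hη in
/-- The tube point over `ptA`, `(expT (shrink w), angBPt ptA)`, lies in the bicollar piece (its level
is `1`). [folklore] -/
theorem tubePtB_mem_bicollarPiece (w : 𝔼 3) :
    (expT ((TubeTwist.const ε hε hεπ).shrink w), angBPt ptA) ∈ bicollarPiece η := by
  rw [mem_bicollarPiece, coe_angBPt_ptA]
  constructor <;> linarith

include hVε in
/-- The tube point off `ptA`, `(expT (shrink w), angAPt u)`, lies in the cylinder piece. [folklore] -/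
theorem tubePtA_mem_cylPiece (u : 𝕊 1) (w : 𝔼 3) :
    (expT ((TubeTwist.const ε hε hεπ).shrink w), angAPt u) ∈ cylPiece V :=
  hVε _ (TubeTwist.norm_shrink_const_lt hε hεπ w)

include he in
/-- **The product tube over the first cylinder is a cylinder point** (the slide fixes the tube
fibres). [folklore] -/
theorem prodTube_eq_cylMap {u : 𝕊 1} (hu : u ≠ ptA) (w : 𝔼 3) :
    (prodTube ψ ε hε hεπ hψ).toFun (u, w) =
      cylMap ψ V K φ₀ ⟨_, tubePtA_mem_cylPiece hε hεπ V hVε u w⟩ := by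
  rw [cylMap, prodTube_apply_of_ne ψ ε hε hεπ hψ hu, cylSlide_apply]
  show _ = (mtGlueData ψ).inl (slideFun K φ₀ _ (expT _), angAPt u)
  rw [he _ _ (TubeTwist.norm_shrink_const_lt hε hεπ w)]

include hη in
/-- **The product tube over `ptA` is a bicollar point.** [folklore] -/
theorem prodTube_eq_bicollarMap (w : 𝔼 3) :
    (prodTube ψ ε hε hεπ hψ).toFun (ptA, w) =
      bicollarMap ψ η ⟨_, tubePtB_mem_bicollarPiece hε hεπ hη w⟩ := by
  rw [bicollarMap, prodTube_apply_of_ne_ptB ψ ε hε hεπ hψ ptA_ne_ptB]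

include hη hVε he in
/-- **The product tube lies in the twisted cylinder neighbourhood.** [folklore] -/
theorem prodTube_mem_twistNbhd (q : (𝕊 1) × (𝔼 3)) :
    (prodTube ψ ε hε hεπ hψ).toFun q ∈ twistNbhd ψ η V K φ₀ := by
  obtain ⟨u, w⟩ := q
  by_cases hu : u = ptA
  · subst hu
    rw [prodTube_eq_bicollarMap ψ hε hεπ hψ hη]
    exact bicollarMap_mem ψ η V K φ₀ _
  · rw [prodTube_eq_cylMap ψ hε hεπ hψ V K φ₀ hVε he hu]
    exact cylMap_mem ψ η V K φ₀ _

include hη hVε he he' in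
/-- **A witnessed diffeomorphism of the neighbourhoods carries product tube to product tube.** [folklore] -/
theorem coe_slideDiffeomorph_prodTube
    (Θ : ↥(twistNbhd ψ η V K φ₀) ≃ₘ⟮𝓡 4, 𝓡 4⟯ ↥(twistNbhd ψ' η V K' φ₀'))
    (hΘc : ∀ a, Θ (cylEmb ψ η V K φ₀ a) = cylEmb ψ' η V K' φ₀' a)
    (hΘb : ∀ b, Θ (bicollarEmb ψ η V K φ₀ b) = bicollarEmb ψ' η V K' φ₀' b)
    (hνU : ∀ q, (prodTube ψ ε hε hεπ hψ).toFun q ∈ twistNbhd ψ η V K φ₀) (q : (𝕊 1) × (𝔼 3)) :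
    ((Θ ⟨(prodTube ψ ε hε hεπ hψ).toFun q, hνU q⟩ : ↥(twistNbhd ψ' η V K' φ₀')) : MTorus ψ') =
      (prodTube ψ' ε hε hεπ hψ').toFun q := by
  obtain ⟨u, w⟩ := q
  by_cases hu : u = ptA
  · subst hu
    have heq : (⟨(prodTube ψ ε hε hεπ hψ).toFun (ptA, w), hνU (ptA, w)⟩ : ↥(twistNbhd ψ η V K φ₀)) =
        bicollarEmb ψ η V K φ₀ ⟨_, tubePtB_mem_bicollarPiece hε hεπ hη w⟩ :=
      Subtype.ext (prodTube_eq_bicollarMap ψ hε hεπ hψ hη w)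
    rw [heq, hΘb, coe_bicollarEmb, prodTube_apply_of_ne_ptB ψ' ε hε hεπ hψ' ptA_ne_ptB]
  · have heq : (⟨(prodTube ψ ε hε hεπ hψ).toFun (u, w), hνU (u, w)⟩ : ↥(twistNbhd ψ η V K φ₀)) =
        cylEmb ψ η V K φ₀ ⟨_, tubePtA_mem_cylPiece hε hεπ V hVε u w⟩ :=
      Subtype.ext (prodTube_eq_cylMap ψ hε hεπ hψ V K φ₀ hVε he hu w)
    rw [heq, hΘc, coe_cylEmb]
    have h' := prodTube_eq_cylMap ψ' hε hεπ hψ' V K' φ₀' hVε he' hu w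
    rw [cylMap] at h'
    exact h'.symm

/-- **First-cylinder points are off the fibre sliver** (the sliver lies on the level `t = 1` of the
second cylinder, which is glued to nothing). [folklore] -/
theorem inl_mem_prodSliverCompl {S : Set ThreeTorus} (hS : IsClosed S) (a : ThreeTorus × ↥mappingTorusPieceOne) :
    (mtGlueData ψ).inl a ∈ prodSliverCompl ψ hS := by
  rw [prodSliverCompl, mem_sliverCompl_iff]
  rintro ⟨b, hb, hab⟩
  rw [eq_comm, mappingTorusGlued_inl_eq_inr_iff] at hab
  exact not_mappingTorusRel_of_coe_snd_eq_one _ _ hb.2 hab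

/-- A second-cylinder point is off the sliver iff it is not a sliver point. [folklore] -/
theorem inr_mem_prodSliverCompl_iff {S : Set ThreeTorus} (hS : IsClosed S) (b : ThreeTorus × ↥mappingTorusPieceTwo) :
    (mtGlueData ψ).inr b ∈ prodSliverCompl ψ hS ↔ b ∉ fibreSliver S := by
  rw [prodSliverCompl, mem_sliverCompl_iff]
  constructor
  · exact fun h hb ↦ h ⟨b, hb, rfl⟩
  · rintro h ⟨b', hb', hbb⟩
    exact h (((mtGlueData ψ).inr_injective hbb) ▸ hb')

/-- **A witnessed diffeomorphism of the neighbourhoods preserves the complement of the sliver.** [folklore] -/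
theorem mem_prodSliverCompl_iff_slideDiffeomorph {S : Set ThreeTorus} (hS : IsClosed S)
    (Θ : ↥(twistNbhd ψ η V K φ₀) ≃ₘ⟮𝓡 4, 𝓡 4⟯ ↥(twistNbhd ψ' η V K' φ₀'))
    (hΘc : ∀ a, Θ (cylEmb ψ η V K φ₀ a) = cylEmb ψ' η V K' φ₀' a)
    (hΘb : ∀ b, Θ (bicollarEmb ψ η V K φ₀ b) = bicollarEmb ψ' η V K' φ₀' b)
    (p : ↥(twistNbhd ψ η V K φ₀)) :
    (p : MTorus ψ) ∈ prodSliverCompl ψ hS ↔ ((Θ p : ↥(twistNbhd ψ' η V K' φ₀')) : MTorus ψ') ∈ prodSliverCompl ψ' hS := by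
  rcases p.2 with ⟨a, ha⟩ | ⟨b, hb⟩
  · have hp : p = cylEmb ψ η V K φ₀ a := Subtype.ext ha.symm
    rw [hp, hΘc, coe_cylEmb, coe_cylEmb]
    exact iff_of_true (inl_mem_prodSliverCompl ψ hS _) (inl_mem_prodSliverCompl ψ' hS _)
  · have hp : p = bicollarEmb ψ η V K φ₀ b := Subtype.ext hb.symm
    rw [hp, hΘb, coe_bicollarEmb, coe_bicollarEmb, inr_mem_prodSliverCompl_iff, inr_mem_prodSliverCompl_iff]

end Compare

/-! ### Conjugating and extending a supported diffeomorphism of a surgered open set (abstract form) -/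

section Abstract

universe u

variable {T : Type u} [TopologicalSpace T] [T2Space T] [ChartedSpace (𝔼 4) T] [IsManifold (𝓡 4) ∞ T]
  [CompactSpace T] {c : 𝕊 1 → T} (ν : CircleNbhd (𝓡 4) c)
  {T' : Type u} [TopologicalSpace T'] [T2Space T'] [ChartedSpace (𝔼 4) T'] [IsManifold (𝓡 4) ∞ T']
  {c' : 𝕊 1 → T'} (ν' : CircleNbhd (𝓡 4) c')
  {U Sc : TopologicalSpace.Opens T} {U' Sc' : TopologicalSpace.Opens T'}
  (Θ : ↥U ≃ₘ⟮𝓡 4, 𝓡 4⟯ ↥U') (hνU : ∀ q, ν.toFun q ∈ U)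
  (hΘν : ∀ q, ((Θ ⟨ν.toFun q, hνU q⟩ : ↥U') : T') = ν'.toFun q)
  (hν'U' : ∀ q, ν'.toFun q ∈ U') (hνS : ∀ q, ν.toFun q ∈ Sc) (hν'S : ∀ q, ν'.toFun q ∈ Sc')
  (hΘS : ∀ p : ↥U, (p : T) ∈ Sc ↔ ((Θ p : ↥U') : T') ∈ Sc')

omit [CompactSpace T] in
/-- If the tube lies in `W`, a point `inl a` of the surgered manifold lies in `W` surgered iff
`a ∈ W`. [folklore] -/
theorem CircleNbhd.inl_mem_localOpens_iff_of_tube {W : TopologicalSpace.Opens T} (hνW : ∀ q, ν.toFun q ∈ W)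
    (a : ↥ν.complement) : ν.glueData.inl a ∈ ν.localOpens W ↔ (a : T) ∈ W :=
  ⟨fun h ↦ by_contra fun ha ↦ ν.inl_not_mem_localOpens hνW ha h, fun ha ↦ ν.inl_mem_localOpens ha⟩

set_option maxHeartbeats 800000 in
include hΘν hν'U' hνS hν'S hΘS in
/-- **Transfer of a supported diffeomorphism along a diffeomorphism of open sets carrying tube to
tube** (abstract form of the locality of Gompf's twisting data). Let `Θ : U ≅ U'` carry the tube `ν`
of `c ⊂ U ⊆ T` to the tube `ν'` of `c' ⊂ U' ⊆ T'` and preserve two further open sets `Sc ⊇ ν`,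
`Sc' ⊇ ν'` (the complements of the slivers). If `G` is a diffeomorphism of `Sc` surgered which is the
identity off a closed set `Ksupp` contained in `U` surgered, then `Sc'` surgered carries a
diffeomorphism `G'`, the identity off a closed subset of `U'` surgered, which on the points `inl' (Θ a)`,
`a ∈ U ∩ Sc`, is `G` read through `Θ`: whenever `G (inl a) = inl a₁` with `a₁ ∈ U`,
`G' (inl' (Θ a)) = inl' (Θ a₁)`. (Conjugate `G` by the induced diffeomorphism of the surgered open sets,
`CircleNbhd.exists_diffeomorph_localOpens`, and extend by the identity, `exists_diffeomorph_extend`.) [cite: Hirsch1976, Ch. 8 §1, Thm. 1.3] -/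
theorem CircleNbhd.exists_transfer_localOpens
    (G : ↥(ν.localOpens Sc) ≃ₘ⟮𝓡 4, 𝓡 4⟯ ↥(ν.localOpens Sc)) (Ksupp : Set ν.Surgered) (hKc : IsClosed Ksupp)
    (hKU : Ksupp ⊆ ν.localOpens U) (hGK : ∀ x : ↥(ν.localOpens Sc), (x : ν.Surgered) ∉ Ksupp → G x = x) :
    ∃ (G' : ↥(ν'.localOpens Sc') ≃ₘ⟮𝓡 4, 𝓡 4⟯ ↥(ν'.localOpens Sc')) (Ksupp' : Set ν'.Surgered),
      IsClosed Ksupp' ∧ Ksupp' ⊆ ν'.localOpens U' ∧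
      (∀ x' : ↥(ν'.localOpens Sc'), (x' : ν'.Surgered) ∉ Ksupp' → G' x' = x') ∧
      ∀ (x' : ↥(ν'.localOpens Sc')) (a a₁ : ↥ν.complement) (haU : (a : T) ∈ U) (haS : (a : T) ∈ Sc),
        (x' : ν'.Surgered) = ν'.glueData.inl (ν.complementExtend ν' Θ hνU hΘν a) →
          (G ⟨ν.glueData.inl a, ν.inl_mem_localOpens haS⟩ : ν.Surgered) = ν.glueData.inl a₁ →
            (a₁ : T) ∈ U →
              (G' x' : ν'.Surgered) = ν'.glueData.inl (ν.complementExtend ν' Θ hνU hΘν a₁) := by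
  have hΨex := ν.exists_diffeomorph_localOpens ν' Θ hνU hΘν
  obtain ⟨Ψ, hΨl, hΨr⟩ := hΨex
  have hinlS := ν.inl_mem_localOpens_iff_of_tube hνS
  have hinlS' := ν'.inl_mem_localOpens_iff_of_tube hν'S
  have hinlU := ν.inl_mem_localOpens_iff_of_tube hνU
  have hinlU' := ν'.inl_mem_localOpens_iff_of_tube hν'U'
  -- `Ψ` preserves the surgered `Sc`
  have hΨS : ∀ x : ↥(ν.localOpens U),
      (x : ν.Surgered) ∈ ν.localOpens Sc ↔ ((Ψ x : ↥(ν'.localOpens U')) : ν'.Surgered) ∈ ν'.localOpens Sc' := by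
    intro x
    rcases (ν.mem_localOpens_iff).1 x.2 with ⟨a, ha, hxa⟩ | ⟨d, hxd⟩
    · rw [← hxa, hΨl x a hxa.symm, hinlS, hinlS', CircleNbhd.coe_complementExtend,
        CircleNbhd.extendMap_of_mem _ Θ ha]
      exact hΘS ⟨a, ha⟩
    · rw [← hxd, hΨr x d hxd.symm]
      exact iff_of_true (ν.inr_mem_localOpens d) (ν'.inr_mem_localOpens d)
  have hΨS' : ∀ x' : ↥(ν'.localOpens U'),
      ((Ψ.symm x' : ↥(ν.localOpens U)) : ν.Surgered) ∈ ν.localOpens Sc ↔ (x' : ν'.Surgered) ∈ ν'.localOpens Sc' := by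
    intro x'
    rw [hΨS (Ψ.symm x'), Diffeomorph.apply_symm_apply]
  -- `G` and `G⁻¹` preserve `Ksupp`, hence `U` surgered
  have hGKmem : ∀ x : ↥(ν.localOpens Sc), (x : ν.Surgered) ∈ Ksupp → (G x : ν.Surgered) ∈ Ksupp := by
    intro x hx
    by_contra hGx
    have h2 : G x = x := G.injective (hGK (G x) hGx)
    exact hGx (by rw [h2]; exact hx)
  have hGK' : ∀ x : ↥(ν.localOpens Sc), (x : ν.Surgered) ∉ Ksupp → G.symm x = x := by
    intro x hx
    conv_lhs => rw [← hGK x hx]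
    exact G.symm_apply_apply x
  have hGK'mem : ∀ x : ↥(ν.localOpens Sc), (x : ν.Surgered) ∈ Ksupp → (G.symm x : ν.Surgered) ∈ Ksupp := by
    intro x hx
    by_contra hGx
    have h1 : G (G.symm x) = G.symm x := hGK (G.symm x) hGx
    rw [Diffeomorph.apply_symm_apply] at h1
    exact hGx (by rw [← h1]; exact hx)
  have hGU : ∀ x : ↥(ν.localOpens Sc), (x : ν.Surgered) ∈ ν.localOpens U → (G x : ν.Surgered) ∈ ν.localOpens U := by
    intro x hx
    by_cases hK : (x : ν.Surgered) ∈ Ksupp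
    · exact hKU (hGKmem x hK)
    · rw [hGK x hK]; exact hx
  have hG'U : ∀ x : ↥(ν.localOpens Sc), (x : ν.Surgered) ∈ ν.localOpens U → (G.symm x : ν.Surgered) ∈ ν.localOpens U := by
    intro x hx
    by_cases hK : (x : ν.Surgered) ∈ Ksupp
    · exact hKU (hGK'mem x hK)
    · rw [hGK' x hK]; exact hx
  -- the open subsets `W ⊆ Sc surgered`, `W' ⊆ Sc' surgered`
  let W : TopologicalSpace.Opens ↥(ν.localOpens Sc) :=
    ⟨{x | (x : ν.Surgered) ∈ ν.localOpens U}, (ν.localOpens U).2.preimage continuous_subtype_val⟩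
  let W' : TopologicalSpace.Opens ↥(ν'.localOpens Sc') :=
    ⟨{x | (x : ν'.Surgered) ∈ ν'.localOpens U'}, (ν'.localOpens U').2.preimage continuous_subtype_val⟩
  -- `G` restricted to `W`
  let GW : ↥W ≃ₘ⟮𝓡 4, 𝓡 4⟯ ↥W :=
    { toFun := fun w ↦ ⟨G w.1, hGU w.1 w.2⟩
      invFun := fun w ↦ ⟨G.symm w.1, hG'U w.1 w.2⟩
      left_inv := fun w ↦ Subtype.ext (G.symm_apply_apply w.1)
      right_inv := fun w ↦ Subtype.ext (G.apply_symm_apply w.1)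
      contMDiff_toFun := by
        rw [← ContMDiff.subtypeVal_comp_iff]
        exact G.contMDiff.comp contMDiff_subtype_val
      contMDiff_invFun := by
        rw [← ContMDiff.subtypeVal_comp_iff]
        exact G.symm.contMDiff.comp contMDiff_subtype_val }
  -- `Ψ` restricted to `W → W'`
  let toU : ↥W → ↥(ν.localOpens U) := fun w ↦ ⟨w.1.1, w.2⟩
  let toU' : ↥W' → ↥(ν'.localOpens U') := fun w ↦ ⟨w.1.1, w.2⟩
  have htoU : ContMDiff (𝓡 4) (𝓡 4) ∞ toU := by
    rw [← ContMDiff.subtypeVal_comp_iff]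
    show ContMDiff (𝓡 4) (𝓡 4) ∞ fun w : ↥W ↦ ((w : ↥(ν.localOpens Sc)) : ν.Surgered)
    exact contMDiff_subtype_val.comp contMDiff_subtype_val
  have htoU' : ContMDiff (𝓡 4) (𝓡 4) ∞ toU' := by
    rw [← ContMDiff.subtypeVal_comp_iff]
    show ContMDiff (𝓡 4) (𝓡 4) ∞ fun w : ↥W' ↦ ((w : ↥(ν'.localOpens Sc')) : ν'.Surgered)
    exact contMDiff_subtype_val.comp contMDiff_subtype_val
  let ΨW : ↥W ≃ₘ⟮𝓡 4, 𝓡 4⟯ ↥W' :=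
    { toFun := fun w ↦ ⟨⟨(Ψ (toU w) : ν'.Surgered), (hΨS (toU w)).1 w.1.2⟩, (Ψ (toU w)).2⟩
      invFun := fun w' ↦ ⟨⟨(Ψ.symm (toU' w') : ν.Surgered), (hΨS' (toU' w')).2 w'.1.2⟩, (Ψ.symm (toU' w')).2⟩
      left_inv := fun w ↦ by
        apply Subtype.ext; apply Subtype.ext
        show ((Ψ.symm ⟨(Ψ (toU w) : ν'.Surgered), (Ψ (toU w)).2⟩ : ↥(ν.localOpens U)) : ν.Surgered) = w.1.1
        rw [Subtype.coe_eta, Diffeomorph.symm_apply_apply]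
      right_inv := fun w' ↦ by
        apply Subtype.ext; apply Subtype.ext
        show ((Ψ ⟨(Ψ.symm (toU' w') : ν.Surgered), (Ψ.symm (toU' w')).2⟩ : ↥(ν'.localOpens U')) : ν'.Surgered) = w'.1.1
        rw [Subtype.coe_eta, Diffeomorph.apply_symm_apply]
      contMDiff_toFun := by
        rw [← ContMDiff.subtypeVal_comp_iff, ← ContMDiff.subtypeVal_comp_iff]
        show ContMDiff (𝓡 4) (𝓡 4) ∞ fun w : ↥W ↦ ((Ψ (toU w) : ↥(ν'.localOpens U')) : ν'.Surgered)
        exact contMDiff_subtype_val.comp (Ψ.contMDiff.comp htoU)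
      contMDiff_invFun := by
        rw [← ContMDiff.subtypeVal_comp_iff, ← ContMDiff.subtypeVal_comp_iff]
        show ContMDiff (𝓡 4) (𝓡 4) ∞ fun w' : ↥W' ↦ ((Ψ.symm (toU' w') : ↥(ν.localOpens U)) : ν.Surgered)
        exact contMDiff_subtype_val.comp (Ψ.symm.contMDiff.comp htoU') }
  -- the conjugate `GW' = ΨW ∘ GW ∘ ΨW⁻¹` on `W'`
  let GW' : ↥W' ≃ₘ⟮𝓡 4, 𝓡 4⟯ ↥W' := ΨW.symm.trans (GW.trans ΨW)
  have hGW'_apply : ∀ w' : ↥W', GW' w' = ΨW (GW (ΨW.symm w')) := fun w' ↦ rfl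
  -- the transported support
  let Ksupp' : Set ν'.Surgered :=
    (fun x : ↥(ν.localOpens U) ↦ ((Ψ x : ↥(ν'.localOpens U')) : ν'.Surgered)) '' {x | (x : ν.Surgered) ∈ Ksupp}
  have hKcpt : IsCompact {x : ↥(ν.localOpens U) | (x : ν.Surgered) ∈ Ksupp} := by
    rw [Topology.IsEmbedding.subtypeVal.isCompact_iff]
    have himg : Subtype.val '' {x : ↥(ν.localOpens U) | (x : ν.Surgered) ∈ Ksupp} = Ksupp := by
      ext p
      constructor
      · rintro ⟨x, hx, rfl⟩
        exact hx
      · intro hp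
        exact ⟨⟨p, hKU hp⟩, hp, rfl⟩
    rw [himg]
    exact hKc.isCompact
  have hK'c : IsClosed Ksupp' :=
    (hKcpt.image (contMDiff_subtype_val.comp Ψ.contMDiff).continuous).isClosed
  have hK'U : Ksupp' ⊆ ν'.localOpens U' := by
    rintro _ ⟨x, -, rfl⟩
    exact (Ψ x).2
  -- the closed set of the extension and the identity off it
  let Kt : Set ↥(ν'.localOpens Sc') := {x' | (x' : ν'.Surgered) ∈ Ksupp'}
  have hKtc : IsClosed Kt := hK'c.preimage continuous_subtype_val
  have hKtW' : Kt ⊆ range (Subtype.val : ↥W' → ↥(ν'.localOpens Sc')) := by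
    intro x' hx'
    rw [Subtype.range_coe]
    exact hK'U hx'
  have hfix : ∀ w' : ↥W', (w' : ↥(ν'.localOpens Sc')) ∉ Kt → GW' w' = w' := by
    intro w' hw'
    have hnot : ((Ψ.symm (toU' w') : ↥(ν.localOpens U)) : ν.Surgered) ∉ Ksupp := by
      intro hK
      apply hw'
      refine ⟨Ψ.symm (toU' w'), hK, ?_⟩
      show ((Ψ (Ψ.symm (toU' w')) : ↥(ν'.localOpens U')) : ν'.Surgered) = _
      rw [Diffeomorph.apply_symm_apply]
    rw [hGW'_apply]
    have h1 : GW (ΨW.symm w') = ΨW.symm w' := Subtype.ext (hGK _ hnot)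
    rw [h1, Diffeomorph.apply_symm_apply]
  have hGex := exists_diffeomorph_extend (Manifold.IsSmoothEmbedding.of_opens W')
    (by rw [Subtype.range_coe]; exact W'.2) GW' hKtc hKtW' hfix
  obtain ⟨G', hG'ι, hG'off⟩ := hGex
  refine ⟨G', Ksupp', hK'c, hK'U, fun x' hx' ↦ ?_, fun x' a a₁ haU haS hx' hGa ha₁U ↦ ?_⟩
  · -- `G'` is the identity off `Ksupp'`
    by_cases hW' : x' ∈ W'
    · have h := hG'ι ⟨x', hW'⟩
      rw [hfix ⟨x', hW'⟩ hx'] at h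
      exact h
    · exact hG'off x' (by rwa [Subtype.range_coe])
  · -- the conjugation formula on `inl' (Θ a)`
    have haU' : (x' : ν'.Surgered) ∈ ν'.localOpens U' := by
      rw [hx', hinlU', CircleNbhd.coe_complementExtend, CircleNbhd.extendMap_of_mem _ Θ haU]
      exact (Θ ⟨a, haU⟩).2
    have h := hG'ι ⟨x', haU'⟩
    rw [show ((⟨x', haU'⟩ : ↥W') : ↥(ν'.localOpens Sc')) = x' from rfl] at h
    rw [h, hGW'_apply]
    -- `ΨW⁻¹ x'` is the point `inl a`
    have hx₀ : ((Ψ.symm (toU' ⟨x', haU'⟩) : ↥(ν.localOpens U)) : ν.Surgered) = ν.glueData.inl a := by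
      have h1 : Ψ ⟨ν.glueData.inl a, (hinlU a).2 haU⟩ = toU' ⟨x', haU'⟩ := by
        apply Subtype.ext
        rw [hΨl _ a rfl]
        exact hx'.symm
      rw [← h1, Diffeomorph.symm_apply_apply]
    -- `a₁ ∈ Sc`: `G (inl a)` lies in `Sc` surgered
    have ha₁S : (a₁ : T) ∈ Sc := by
      have h4 := (G ⟨ν.glueData.inl a, ν.inl_mem_localOpens haS⟩).2
      rw [show ((G ⟨ν.glueData.inl a, ν.inl_mem_localOpens haS⟩ : ↥(ν.localOpens Sc)) : ν.Surgered) =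
        ν.glueData.inl a₁ from hGa, hinlS] at h4
      exact h4
    have hGx₀ : ((GW (ΨW.symm ⟨x', haU'⟩) : ↥W) : ↥(ν.localOpens Sc)) =
        ⟨ν.glueData.inl a₁, (hinlS a₁).2 ha₁S⟩ := by
      show G (ΨW.symm ⟨x', haU'⟩).1 = _
      have h2 : (ΨW.symm ⟨x', haU'⟩).1 = ⟨ν.glueData.inl a, ν.inl_mem_localOpens haS⟩ := Subtype.ext hx₀
      rw [h2]
      exact Subtype.ext hGa
    show ((Ψ (toU (GW (ΨW.symm ⟨x', haU'⟩))) : ↥(ν'.localOpens U')) : ν'.Surgered) = _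
    have h3 : toU (GW (ΨW.symm ⟨x', haU'⟩)) = ⟨ν.glueData.inl a₁, (hinlU a₁).2 ha₁U⟩ := by
      apply Subtype.ext
      show (((GW (ΨW.symm ⟨x', haU'⟩) : ↥W) : ↥(ν.localOpens Sc)) : ν.Surgered) = ν.glueData.inl a₁
      rw [hGx₀]
    rw [h3, hΨl _ a₁ rfl]

end Abstract

/-! ### The transfer theorem -/

section Transfer

variable (ψ ψ' : ThreeTorus ≃ₘ⟮𝓣, 𝓣⟯ ThreeTorus) {ε : ℝ} (hε : 0 < ε) (hεπ : ε ≤ π)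
  (hψ : ∀ v : 𝔼 3, ‖v‖ < ε → ψ (expT v) = expT v)
  (hψ' : ∀ v : 𝔼 3, ‖v‖ < ε → ψ' (expT v) = expT v)
  {η : ℝ} (hη : 0 < η) (V : TopologicalSpace.Opens ThreeTorus)
  (K K' : Diffeotopy 𝓣 ThreeTorus) (φ₀ φ₀' : ThreeTorus ≃ₘ⟮𝓣, 𝓣⟯ ThreeTorus)
  (hVε : ∀ v : 𝔼 3, ‖v‖ < ε → expT v ∈ V)
  (he : ∀ (s : ℝ) (v : 𝔼 3), ‖v‖ < ε → slideFun K φ₀ s (expT v) = expT v)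
  (he' : ∀ (s : ℝ) (v : 𝔼 3), ‖v‖ < ε → slideFun K' φ₀' s (expT v) = expT v)
  (htop : ∀ s : ℝ, 1 - η < s → s < 1 → ∀ x ∈ V, slideFun K φ₀ s x = slideFun K' φ₀' s x)
  (hbot : ∀ s : ℝ, 0 < s → s < η → ∀ x ∈ V, ψ (slideFun K φ₀ s x) = ψ' (slideFun K' φ₀' s x))
  (g : ThreeTorus → ThreeTorus) {S : Set ThreeTorus} (hS : IsClosed S)
  (hSε : ∀ v : 𝔼 3, ‖v‖ < ε → expT v ∉ S)
  (Vδ : TopologicalSpace.Opens (ThreeTorus × ↥mappingTorusPieceTwo))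
  (hV1 : ∀ b ∈ Vδ, b.1 ≠ 1) (hVη : ∀ b ∈ Vδ, b ∈ bicollarPiece η)

set_option maxHeartbeats 800000 in
include hη hVε he he' htop hbot hSε hVη in
/-- **The transfer theorem (locality of Gompf's twisting criterion).** Let `ψ, ψ'` be monodromies of
`T³` which are the identity on `expT (B(0, ε))`, with sliding families `e = φ₀ ∘ K`, `e' = φ₀' ∘ K'`
fixing those tube fibres (which lie in the tube `V ⊆ T³` around `α`), agreeing on `V` near the top of
the cylinder and, after `ψ` resp. `ψ'`, near its bottom. Suppose `G` are twisting data for `ψ`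
(a diffeomorphism of `prodSurgered ψ ε` minus the sliver of `S`, twisting by `g` across the sliver on
the neighbourhood `V_δ` of the sliver inside the bicollar, hypotheses of
`nonempty_diffeomorph_prodSurgered_of_twistingDiffeo`) which are the identity off a closed set
`Ksupp` of the surgered twisted cylinder neighbourhood `twistNbhd ψ η V K φ₀`. Then `ψ'` carries twisting
data for the same `g, S, V_δ`, the identity off a closed subset of its own surgered twisted cylinder
neighbourhood: Gompf's fishtail diffeomorphism, built once in a model, serves every monodromy with
the same germ on the cylinder of `α`. [cite: GompfAGT2010, Thm 2.1 (proof: the construction lives in a neighbourhood of N ∪ F′; last paragraph)] -/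
theorem exists_twistingDiffeo_transfer
    (G : ↥((prodTube ψ ε hε hεπ hψ).localOpens (prodSliverCompl ψ hS)) ≃ₘ⟮𝓡 4, 𝓡 4⟯
      ↥((prodTube ψ ε hε hεπ hψ).localOpens (prodSliverCompl ψ hS)))
    (hG : ∀ (x : ↥((prodTube ψ ε hε hεπ hψ).localOpens (prodSliverCompl ψ hS))) (b : ↥Vδ),
      (b : ThreeTorus × ↥mappingTorusPieceTwo) ∉ fibreSliver S →
        (x : prodSurgered ψ ε hε hεπ hψ) = (prodTube ψ ε hε hεπ hψ).glueData.inl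
          (opensToComplement (prodTube ψ ε hε hεπ hψ) (mtGlueData ψ).inr Vδ
            (inr_not_mem_range_secCircle_self ψ hε hεπ hψ Vδ hV1) b) →
          ∃ a' : ↥(prodTube ψ ε hε hεπ hψ).complement,
            (a' : MTorus ψ) = (mtGlueData ψ).inr (sliverTwist g b) ∧
              (G x : prodSurgered ψ ε hε hεπ hψ) = (prodTube ψ ε hε hεπ hψ).glueData.inl a')
    (Ksupp : Set (prodSurgered ψ ε hε hεπ hψ)) (hKc : IsClosed Ksupp)
    (hKU : Ksupp ⊆ (prodTube ψ ε hε hεπ hψ).localOpens (twistNbhd ψ η V K φ₀))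
    (hGK : ∀ x : ↥((prodTube ψ ε hε hεπ hψ).localOpens (prodSliverCompl ψ hS)),
      (x : prodSurgered ψ ε hε hεπ hψ) ∉ Ksupp → G x = x) :
    ∃ (G' : ↥((prodTube ψ' ε hε hεπ hψ').localOpens (prodSliverCompl ψ' hS)) ≃ₘ⟮𝓡 4, 𝓡 4⟯
        ↥((prodTube ψ' ε hε hεπ hψ').localOpens (prodSliverCompl ψ' hS)))
      (Ksupp' : Set (prodSurgered ψ' ε hε hεπ hψ')),
      IsClosed Ksupp' ∧ Ksupp' ⊆ (prodTube ψ' ε hε hεπ hψ').localOpens (twistNbhd ψ' η V K' φ₀') ∧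
      (∀ x : ↥((prodTube ψ' ε hε hεπ hψ').localOpens (prodSliverCompl ψ' hS)),
        (x : prodSurgered ψ' ε hε hεπ hψ') ∉ Ksupp' → G' x = x) ∧
      ∀ (x : ↥((prodTube ψ' ε hε hεπ hψ').localOpens (prodSliverCompl ψ' hS))) (b : ↥Vδ),
        (b : ThreeTorus × ↥mappingTorusPieceTwo) ∉ fibreSliver S →
          (x : prodSurgered ψ' ε hε hεπ hψ') = (prodTube ψ' ε hε hεπ hψ').glueData.inl
            (opensToComplement (prodTube ψ' ε hε hεπ hψ') (mtGlueData ψ').inr Vδ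
              (inr_not_mem_range_secCircle_self ψ' hε hεπ hψ' Vδ hV1) b) →
            ∃ a' : ↥(prodTube ψ' ε hε hεπ hψ').complement,
              (a' : MTorus ψ') = (mtGlueData ψ').inr (sliverTwist g b) ∧
                (G' x : prodSurgered ψ' ε hε hεπ hψ') = (prodTube ψ' ε hε hεπ hψ').glueData.inl a' := by
  -- the comparison of the neighbourhoods
  have hΘex := exists_slideDiffeomorph ψ ψ' (η := η) V K K' φ₀ φ₀' htop hbot
  obtain ⟨Θ, hΘc, hΘb⟩ := hΘex
  have hνU : ∀ q, (prodTube ψ ε hε hεπ hψ).toFun q ∈ twistNbhd ψ η V K φ₀ :=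
    prodTube_mem_twistNbhd ψ hε hεπ hψ hη V K φ₀ hVε he
  have hν'U' : ∀ q, (prodTube ψ' ε hε hεπ hψ').toFun q ∈ twistNbhd ψ' η V K' φ₀' :=
    prodTube_mem_twistNbhd ψ' hε hεπ hψ' hη V K' φ₀' hVε he'
  have hΘν := coe_slideDiffeomorph_prodTube ψ ψ' hε hεπ hψ hψ' hη V K K' φ₀ φ₀' hVε he he' Θ hΘc hΘb hνU
  have hνS : ∀ q, (prodTube ψ ε hε hεπ hψ).toFun q ∈ prodSliverCompl ψ hS :=
    prodTube_mem_sliverCompl ψ hε hεπ hψ hS hSε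
  have hν'S : ∀ q, (prodTube ψ' ε hε hεπ hψ').toFun q ∈ prodSliverCompl ψ' hS :=
    prodTube_mem_sliverCompl ψ' hε hεπ hψ' hS hSε
  have hΘS := mem_prodSliverCompl_iff_slideDiffeomorph ψ ψ' V K K' φ₀ φ₀' hS Θ hΘc hΘb
  have htr := (prodTube ψ ε hε hεπ hψ).exists_transfer_localOpens (prodTube ψ' ε hε hεπ hψ') Θ hνU hΘν hν'U'
    hνS hν'S hΘS G Ksupp hKc hKU hGK
  obtain ⟨G', Ksupp', hK'c, hK'U, hG'K, hG'conj⟩ := htr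
  refine ⟨G', Ksupp', hK'c, hK'U, hG'K, fun x b hbS hx ↦ ?_⟩
  -- the point `b` of the bicollar and its twist
  have hψ1 : ψ 1 = 1 := by have h := hψ 0 (by simpa using hε); rwa [expT_zero] at h
  have hψ'1 : ψ' 1 = 1 := by have h := hψ' 0 (by simpa using hε); rwa [expT_zero] at h
  let a : ↥(prodTube ψ ε hε hεπ hψ).complement := opensToComplement (prodTube ψ ε hε hεπ hψ)
    (mtGlueData ψ).inr Vδ (inr_not_mem_range_secCircle_self ψ hε hεπ hψ Vδ hV1) b
  have hbU : (b : ThreeTorus × ↥mappingTorusPieceTwo) ∈ bicollarPiece η := hVη b b.2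
  have haU : (a : MTorus ψ) ∈ twistNbhd ψ η V K φ₀ := bicollarMap_mem ψ η V K φ₀ ⟨b, hbU⟩
  have haS : (a : MTorus ψ) ∈ prodSliverCompl ψ hS := (inr_mem_prodSliverCompl_iff ψ hS _).2 hbS
  -- `Θ a = inr' b`, so `x = inl' (Θ a)`
  have hΘa : ((Θ ⟨(a : MTorus ψ), haU⟩ : ↥(twistNbhd ψ' η V K' φ₀')) : MTorus ψ') = (mtGlueData ψ').inr b := by
    have h1 : (⟨(a : MTorus ψ), haU⟩ : ↥(twistNbhd ψ η V K φ₀)) = bicollarEmb ψ η V K φ₀ ⟨b, hbU⟩ := rfl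
    rw [h1, hΘb, coe_bicollarEmb]
  have hx' : (x : prodSurgered ψ' ε hε hεπ hψ') = (prodTube ψ' ε hε hεπ hψ').glueData.inl
      ((prodTube ψ ε hε hεπ hψ).complementExtend (prodTube ψ' ε hε hεπ hψ') Θ hνU hΘν a) := by
    rw [hx]
    congr 1
    apply Subtype.ext
    rw [coe_opensToComplement, CircleNbhd.coe_complementExtend, CircleNbhd.extendMap_of_mem _ Θ haU, hΘa]
  -- `G (inl a) = inl a₁` with `a₁ = inr (sliverTwist g b)`
  have hGex := hG ⟨(prodTube ψ ε hε hεπ hψ).glueData.inl a,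
    (prodTube ψ ε hε hεπ hψ).inl_mem_localOpens haS⟩ b hbS rfl
  obtain ⟨a₁, ha₁, hGa⟩ := hGex
  have hb₁U : sliverTwist g (b : ThreeTorus × ↥mappingTorusPieceTwo) ∈ bicollarPiece η := by
    rw [mem_bicollarPiece, sliverTwist_snd]; exact hbU
  have ha₁U : (a₁ : MTorus ψ) ∈ twistNbhd ψ η V K φ₀ := by
    rw [ha₁]; exact bicollarMap_mem ψ η V K φ₀ ⟨_, hb₁U⟩
  have hΘa₁ : ((Θ ⟨(a₁ : MTorus ψ), ha₁U⟩ : ↥(twistNbhd ψ' η V K' φ₀')) : MTorus ψ') =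
      (mtGlueData ψ').inr (sliverTwist g b) := by
    have h1 : (⟨(a₁ : MTorus ψ), ha₁U⟩ : ↥(twistNbhd ψ η V K φ₀)) = bicollarEmb ψ η V K φ₀ ⟨_, hb₁U⟩ :=
      Subtype.ext ha₁
    rw [h1, hΘb, coe_bicollarEmb]
  refine ⟨(prodTube ψ ε hε hεπ hψ).complementExtend (prodTube ψ' ε hε hεπ hψ') Θ hνU hΘν a₁, ?_,
    hG'conj x a a₁ haU haS hx' hGa ha₁U⟩
  rw [CircleNbhd.coe_complementExtend, CircleNbhd.extendMap_of_mem _ Θ ha₁U, hΘa₁]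

end Transfer

end Literature.Topology.FourManifolds
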